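import Summits.QuantumFields.BalabanUV.Beta.FP.ConstrainedBiLaplacianFibre

/-!
# `BalabanUV.Beta.FP.ConstrainedBiLaplacianFibreEntries` — road «FP» for binder row D1, row **RHOA-4-GH (localisation half)** as re-worded
# by R-FP-29: FILE 2b of 3 — THE REGROUPED ALIAS-FIBRE ENTRIES `Gfib` OF THE CONSTRAINED INVERSE OF `(Δ^ξ)^s`, THEIR IDENTIFICATION WITH
# THE SHERMAN–MORRISON ENTRIES, `n`-UNIFORM WEIGHTED BOUNDS AND HOLOMORPHY ON THE STRIP `Strip d (kappaB d s)`

NOT IN PRINT; OUR PROOF ATTEMPT (binder row G-an2-4 ∕ (CONV-C), prover part P3, fibre∕strip lineage).  HONEST DEPENDENCY (cell records,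
verbatim): «continuum YM on T⁴ ⇐ BetaPertH ∧ nine spine estimates (0/9 proved); BetaPertH ⇐ (D1) ∧ (D4) ∧ CAP+tail; G-an2-4 gates asym, D1
and NE2/3/4.»  HONEST FRAMING (cell contract, verbatim): «discharging `BetaPertH` makes Bałaban's UV stability UNCONDITIONAL — a real
constructive-QFT result; it is NOT the continuum limit and NOT the Clay problem.»  ABSOLUTE RULE (cell charter, verbatim): «No internally-minted
statement may enter as a cited fact. Every hypothesis is either kernel-proved in this package or a verbatim quotation of a PUBLISHED theorem with
page reference. The manuscript(s) under audit are NOT citable for their own disputed steps — they are the thing under adjudication;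
programme-internal (2001/route/tribunal) claims are never citable.»  THIS MODULE is [folklore] algebra and complex analysis over FILE 1
`FP/ConstrainedBiLaplacianStrip` (`den`, `kappaB`, `cB`, `norm_den_ge_strip`, `norm_inv_den_le_strip`) and FILE 2a `FP/ConstrainedBiLaplacianFibre`
(`Fc`, `ainv`, `Spr`, `den_eq_U_add_mul_Spr`, bounds); it re-defines no symbol, cites nothing as a hypothesis, has no `def … : Prop` and no `sorry`.

## The entries (every `d`, every `n ≥ 1`, every order `s`)

With `A_k = (Δ^ξ(p′+2πk))^s`, `a_k = A_k⁻¹` (`k ≠ 0`), `u_k = F n 0 k p′`, `ũ_k = Fc n 0 k p′`, `S′ = Spr = Σ_{k≠0} U_k a_k`, `den = U_0 + A_0 S′`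
(`= A_0·⟨ũ, A⁻¹u⟩`): `Gfib 0 0 = S′∕den`, `Gfib 0 k′ = −u_0 ũ_{k′} a_{k′}∕den`, `Gfib k 0 = −u_k ũ_0 a_k∕den`, `Gfib k k′ = δ_{kk′} a_k − A_0 u_k ũ_{k′} a_k a_{k′}∕den`
(`k, k′ ≠ 0`).  **`Gfib_eq_unregrouped`**: wherever `A_0 ≠ 0` (and `den ≠ 0`) these ARE the Sherman–Morrison entries
`δ_{kk′}∕A_k − u_k ũ_{k′}∕(A_k A_{k′}·(den∕A_0))` of FILE 2a §0 — including the `(0,0)` cancellation `1∕A_0 − U_0∕(A_0·den) = S′∕den`; at `p′ = 0`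
(`A_0 = 0`) the un-regrouped entries are singular while `Gfib` is holomorphic on the whole strip (§3).

## Contents

* §1 `side`, `coef`, **`Gfib`**, **`Gfib_eq_unregrouped`**.
* §2 BOUNDS on `Strip d (kappaB d s)`, uniformly in `n ≥ 1`: `sideWt`, `wt n s k = (Π_ν 12∕ω_n(k_ν))·sideWt n s k`, `norm_F_zero_le`∕`norm_Fc_zero_le`
  (`|u_k|, |ũ_k| ≤ Π_ν 12∕ω`), `CG d s = ((16d)^s + 1)∕cB d`, `norm_coef_le`, **`norm_Gfib_le`**
  (`‖Gfib k k′‖ ≤ [k = k′ ≠ 0]((64∕7)∕W_k)^s + CG·wt k·wt k′` off `(0,0)`), **`norm_Gfib_zero_zero_le`** (`≤ 132^d(64∕7)^s∕cB`).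
* §3 HOLOMORPHY on the strip: `differentiableAt_side`, `differentiableAt_coef`, **`differentiableAt_Gfib`**.

NOT HERE (honest; FILE 3 `FP/ConstrainedBiLaplacianKernel`, same lineage, statement-first): the offset-pair multipliers
`n^{−d}Σ_{kk′} F(τ,k)·[…]·Fc(σ,k′)`, their side periodicity (`Gfib ∘ tr = Gfib ∘ σ_μ` on the strip sides — a four-case identity through
`Gfib_eq_unregrouped`, `F_tr`, `Fc_tr`, `DeltaXi_shift_tr`), `StripRegular` and `B4ContourShift.latticeKernel_decay`; the weight sums `Σ_k wt n s k`
(n-uniform: `B4StripSums.sum_omega_rpow_le`) and the diagonal sum `Σ_{k≠0}((64∕7)∕W_k)^s` (NOT n-uniform at `(s, d) = (2, 4)` — the located `log n`;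
n-uniform in the alias-operator norm).  0∕4 row-D1 binders touched.  NOT RHOA-4-GH, NOT hbook, NOT D1, NOT BetaPertH, NOT continuum, NOT Clay.
Provenance: prover-b2b-balaban-gan24-p3-g21-0 (unit `b2b-balaban-gan24-p3`, gen 21; R-FP-29 first refusal), 2026-08-21.
-/

noncomputable section

namespace Summit.QuantumFields.BalabanUV.Beta.FP.ConstrainedBiLaplacianFibreEntries

open Complex Finset
open Literature.MathematicalPhysics.QuantumFieldTheory.Balaban1983to89
open Literature.MathematicalPhysics.QuantumFieldTheory.Balaban1983to89.B4Strip
open Literature.MathematicalPhysics.QuantumFieldTheory.Balaban1983to89.B4StripCauchy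
open Literature.MathematicalPhysics.QuantumFieldTheory.Balaban1983to89.B5Strip145Analytic
open Literature.MathematicalPhysics.QuantumFieldTheory.Balaban1983to89.B4StripSums
open Summit.QuantumFields.BalabanUV.Beta.FP.ConstrainedBiLaplacianStrip
open Summit.QuantumFields.BalabanUV.Beta.FP.ConstrainedBiLaplacianFibre
open scoped Real

variable {d : ℕ}

/-! ## §1 The regrouped fibre entries -/

/-- [folklore] The side factor of the rank-one part: `1` at `k = 0`, `ainv_k` at `k ≠ 0`. -/
def side (n : ℕ) [NeZero n] (s : ℕ) (k : Fin d → Fin n) (p : Fin d → ℂ) : ℂ :=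
  if k = fun _ => (0 : Fin n) then 1 else ainv n s k p

/-- [folklore] The scalar coefficient of the rank-one part, regrouped through `den`:
`coef k k′ = [k ≠ 0 ∧ k′ ≠ 0](Δ^ξ)^s · side_k · side_{k′} ∕ den`. -/
def coef (n : ℕ) [NeZero n] (s : ℕ) (k k' : Fin d → Fin n) (p : Fin d → ℂ) : ℂ :=
  (if k ≠ (fun _ => (0 : Fin n)) ∧ k' ≠ (fun _ => (0 : Fin n)) then DeltaXi n 0 p ^ s else 1) *
    side n s k p * side n s k' p / den n s p

/-- [folklore] **THE REGROUPED ALIAS-FIBRE ENTRIES OF THE CONSTRAINED INVERSE OF `(Δ^ξ)^s`**: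
`Gfib 0 0 = Spr∕den`; otherwise `Gfib k k′ = [k = k′]·ainv_k − v_k·ṽ_{k′}·coef k k′` (`v_k = F n 0 k`, `ṽ_{k′} = Fc n 0 k′`: the
block-averaging factor and its conjugate without sub-lattice phase). -/
def Gfib (n : ℕ) [NeZero n] (s : ℕ) (k k' : Fin d → Fin n) (p : Fin d → ℂ) : ℂ :=
  if k = (fun _ => (0 : Fin n)) ∧ k' = (fun _ => (0 : Fin n)) then Spr n s p / den n s p
  else (if k = k' then ainv n s k p else 0) - F n (fun _ => 0) k p * Fc n (fun _ => 0) k' p * coef n s k k' p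

/-- [folklore] **THE REGROUPED ENTRIES ARE THE SHERMAN–MORRISON ENTRIES** wherever the regrouping factor does not vanish: if
`Δ^ξ(p) ≠ 0` and `den n s p ≠ 0` (and the shifted symbols do not vanish) then, with `A_k = (Δ^ξ(p′+2πk))^s`,
`Gfib k k′ p = δ_{kk′}∕A_k − v_k ṽ_{k′}∕(A_k A_{k′} (den∕A_0))` for ALL `k, k′` — the `k = k′ = 0` cancellation
`1∕A_0 − U_0∕(A_0 den) = Spr∕den` included, using `v_0 ṽ_0 = U_0` supplied as the hypothesis `hU0` (on the real zone it is `|u_0|²`,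
`B4StripSums.norm_v_sq`); `den∕A_0 = Σ_k ũ_k u_k∕A_k` is the Sherman–Morrison `S` of §0. -/
theorem Gfib_eq_unregrouped (n : ℕ) [NeZero n] (s : ℕ) (k k' : Fin d → Fin n) (p : Fin d → ℂ)
    (h0 : DeltaXi n 0 p ≠ 0) (hden : den n s p ≠ 0) (hk : ∀ j : Fin d → Fin n, DeltaXi n 0 (shift n j p) ≠ 0)
    (hU0 : F n (fun _ => 0) (fun _ => (0 : Fin n)) p * Fc n (fun _ => 0) (fun _ => (0 : Fin n)) p = U n (fun _ => (0 : Fin n)) p) :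
    Gfib n s k k' p = (if k = k' then (DeltaXi n 0 (shift n k p) ^ s)⁻¹ else 0)
      - F n (fun _ => 0) k p * Fc n (fun _ => 0) k' p /
        (DeltaXi n 0 (shift n k p) ^ s * DeltaXi n 0 (shift n k' p) ^ s * (den n s p / DeltaXi n 0 p ^ s)) := by
  have hAk : ∀ j : Fin d → Fin n, DeltaXi n 0 (shift n j p) ^ s ≠ 0 := fun j => pow_ne_zero s (hk j)
  have hA0 : DeltaXi n 0 p ^ s ≠ 0 := pow_ne_zero s h0
  have hsh0 : shift n (fun _ => (0 : Fin n)) p = p := shift_zero n p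
  unfold Gfib coef side
  by_cases hk0 : k = fun _ => (0 : Fin n)
  · by_cases hk0' : k' = fun _ => (0 : Fin n)
    · -- the cancellation at k = k' = 0
      subst hk0; subst hk0'
      rw [if_pos ⟨rfl, rfl⟩, if_pos rfl, hU0, hsh0]
      have hden' : U n (fun _ => (0 : Fin n)) p + DeltaXi n 0 p ^ s * Spr n s p ≠ 0 := by
        rw [← den_eq_U_add_mul_Spr]; exact hden
      rw [den_eq_U_add_mul_Spr]
      have e1 : DeltaXi n 0 p ^ s * DeltaXi n 0 p ^ s * ((U n (fun _ => (0 : Fin n)) p + DeltaXi n 0 p ^ s * Spr n s p) /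
          DeltaXi n 0 p ^ s) = DeltaXi n 0 p ^ s * (U n (fun _ => (0 : Fin n)) p + DeltaXi n 0 p ^ s * Spr n s p) := by
        field_simp
      rw [e1, eq_sub_iff_add_eq, div_add_div _ _ hden' (mul_ne_zero hA0 hden'), div_eq_iff (mul_ne_zero hden' (mul_ne_zero hA0 hden')),
        inv_mul_eq_div, eq_div_iff hA0]
      ring
    · subst hk0
      have hAk' := hAk k'
      have hne : ¬((fun _ => (0 : Fin n)) = k') := fun h => hk0' h.symm
      simp only [hne, hk0', and_false, false_and, if_false, if_true, ne_eq, not_true_eq_false, one_mul, hsh0,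
        zero_sub]
      unfold ainv
      field_simp
  · by_cases hk0' : k' = fun _ => (0 : Fin n)
    · subst hk0'
      have hAk' := hAk k
      simp only [hk0, and_true, and_false, if_false, if_true, ne_eq, not_true_eq_false, not_false_eq_true, mul_one, hsh0,
        zero_sub]
      unfold ainv
      field_simp
    · have hAk1 := hAk k
      have hAk2 := hAk k'
      simp only [hk0, hk0', and_self, if_false, ne_eq, not_false_eq_true, if_true]
      unfold ainv
      by_cases hkk : k = k'
      · subst hkk
        simp only [if_true]
        field_simp
      · simp only [hkk, if_false, zero_sub]
        field_simp

/-! ## §2 Bounds on the strip `Strip d (kappaB d s)`, uniformly in `n ≥ 1` -/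

/-- [folklore] The side weight: `1` at `k = 0`, `((64∕7)∕W_k)^s` at `k ≠ 0`. -/
def sideWt (n : ℕ) [NeZero n] (s : ℕ) (k : Fin d → Fin n) : ℝ :=
  if k = fun _ => (0 : Fin n) then 1 else ((64 / 7) / W n k) ^ s

/-- [folklore] `0 ≤ sideWt`. -/
theorem sideWt_nonneg (n : ℕ) [NeZero n] (s : ℕ) (k : Fin d → Fin n) : 0 ≤ sideWt n s k := by
  unfold sideWt
  split_ifs with h
  · exact zero_le_one
  · have := one_le_W n k h; positivity

/-- [folklore] `sideWt ≤ (64∕7)^s` (`W ≥ 1`). -/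
theorem sideWt_le (n : ℕ) [NeZero n] (s : ℕ) (k : Fin d → Fin n) : sideWt n s k ≤ (64 / 7) ^ s := by
  unfold sideWt
  split_ifs with h
  · exact one_le_pow₀ (by norm_num)
  · have hW := one_le_W n k h
    refine pow_le_pow_left₀ (by positivity) ?_ s
    rw [div_le_iff₀ (by linarith)]
    nlinarith

/-- [folklore] `‖side n s k q‖ ≤ sideWt n s k` on the fat region. -/
theorem norm_side_le (n : ℕ) [NeZero n] (s : ℕ) {r : ℝ} (hr : r ≤ 1 / 4) (hdr : (d : ℝ) * r ^ 2 ≤ 1 / 16) {q : Fin d → ℂ}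
    (hq : q ∈ Fat d r) (k : Fin d → Fin n) : ‖side n s k q‖ ≤ sideWt n s k := by
  unfold side sideWt
  split_ifs with h
  · rw [norm_one]
  · exact norm_ainv_le n s hr hdr hq k h

/-- [folklore] The weight of an alias index in the entry bounds: `wt n s k = (Π_ν 12∕ω_n(k_ν))·sideWt n s k`. -/
def wt (n : ℕ) [NeZero n] (s : ℕ) (k : Fin d → Fin n) : ℝ := (∏ ν, 12 / omega n (k ν)) * sideWt n s k

/-- [folklore] `0 ≤ wt`. -/
theorem wt_nonneg (n : ℕ) [NeZero n] (s : ℕ) (k : Fin d → Fin n) : 0 ≤ wt n s k := by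
  unfold wt
  refine mul_nonneg (Finset.prod_nonneg fun ν _ => ?_) (sideWt_nonneg n s k)
  have := omega_pos n (k ν) (k ν).isLt
  positivity

/-- [folklore] `|v_k| = ‖F n 0 k q‖ ≤ Π_ν 12∕ω_n(k_ν)` on the fat region (the phase-free numerator; `B4StripSums.norm_v_le`). -/
theorem norm_F_zero_le (n : ℕ) [NeZero n] {r : ℝ} (hr : r ≤ 1 / 4) (k : Fin d → Fin n) {q : Fin d → ℂ} (hq : q ∈ Fat d r) :
    ‖F n (fun _ => 0) k q‖ ≤ ∏ ν, 12 / omega n (k ν) := by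
  unfold F
  rw [norm_prod]
  refine Finset.prod_le_prod (fun _ _ => norm_nonneg _) (fun ν _ => ?_)
  rw [norm_mul]
  have h1 : ‖ef n (k ν) ((fun _ => (0 : Fin n)) ν : ℕ) (q ν)‖ = 1 := by
    unfold ef; simp
  rw [h1, one_mul]
  exact norm_v_le n (k ν) hr (hq ν).1 (hq ν).2

/-- [folklore] `|ṽ_k| = ‖Fc n 0 k q‖ ≤ Π_ν 12∕ω_n(k_ν)` on the fat region. -/
theorem norm_Fc_zero_le (n : ℕ) [NeZero n] {r : ℝ} (hr : r ≤ 1 / 4) (k : Fin d → Fin n) {q : Fin d → ℂ} (hq : q ∈ Fat d r) :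
    ‖Fc n (fun _ => 0) k q‖ ≤ ∏ ν, 12 / omega n (k ν) := by
  unfold Fc
  rw [norm_prod]
  refine Finset.prod_le_prod (fun _ _ => norm_nonneg _) (fun ν _ => ?_)
  rw [norm_mul]
  have h1 : ‖efc n (k ν) ((fun _ => (0 : Fin n)) ν : ℕ) (q ν)‖ = 1 := by
    unfold efc; simp
  rw [h1, one_mul]
  exact norm_vc_le n (k ν) hr (hq ν).1 (hq ν).2

/-- [folklore] The constant of the rank-one part: `CG d s = ((16 d)^s + 1)∕cB d` (`‖(Δ^ξ)^s‖ ≤ (16d)^s` on the fat region, `‖den⁻¹‖ ≤ (cB d)⁻¹`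
on the strip). -/
def CG (d s : ℕ) : ℝ := ((16 * (d : ℝ)) ^ s + 1) / cB d

/-- [folklore] `0 ≤ CG d s`. -/
theorem CG_nonneg (d s : ℕ) : 0 ≤ CG d s := by
  unfold CG; have := cB_pos d; positivity

/-- [folklore] **THE COEFFICIENT BOUND** on the strip: `‖coef n s k k′ p‖ ≤ CG d s · sideWt k · sideWt k′`, every `n ≥ 1`. -/
theorem norm_coef_le (n : ℕ) [NeZero n] (s : ℕ) (k k' : Fin d → Fin n) {p : Fin d → ℂ} (hp : p ∈ Strip d (kappaB d s)) :
    ‖coef n s k k' p‖ ≤ CG d s * sideWt n s k * sideWt n s k' := by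
  have hn : 1 ≤ n := Nat.one_le_iff_ne_zero.mpr (NeZero.ne n)
  have hfat : p ∈ Fat d (rOf d) := strip_subset_fat (rOf_pos d).le (kappaB_le_rOf d s) hp
  have hpre : ‖(if k ≠ (fun _ => (0 : Fin n)) ∧ k' ≠ (fun _ => (0 : Fin n)) then DeltaXi n 0 p ^ s else (1 : ℂ))‖
      ≤ (16 * (d : ℝ)) ^ s + 1 := by
    split_ifs
    · rw [norm_pow]
      have h := norm_DeltaXi_le n hn 0 le_rfl (rOf_le d) hfat
      rw [add_zero] at h
      have : ‖DeltaXi n 0 p‖ ^ s ≤ (16 * (d : ℝ)) ^ s := pow_le_pow_left₀ (norm_nonneg _) h s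
      linarith
    · rw [norm_one]
      have : (0 : ℝ) ≤ (16 * (d : ℝ)) ^ s := by positivity
      linarith
  have hs1 := norm_side_le n s (rOf_le d) (d_mul_rOf_sq_le d) hfat k
  have hs2 := norm_side_le n s (rOf_le d) (d_mul_rOf_sq_le d) hfat k'
  have hdi := norm_inv_den_le_strip n s hp
  have h1 : (0 : ℝ) ≤ (16 * (d : ℝ)) ^ s + 1 := by positivity
  unfold coef
  rw [div_eq_mul_inv, norm_mul, norm_mul, norm_mul]
  calc ‖(if k ≠ (fun _ => (0 : Fin n)) ∧ k' ≠ (fun _ => (0 : Fin n)) then DeltaXi n 0 p ^ s else (1 : ℂ))‖ * ‖side n s k p‖ *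
        ‖side n s k' p‖ * ‖(den n s p)⁻¹‖
      ≤ ((16 * (d : ℝ)) ^ s + 1) * sideWt n s k * sideWt n s k' * (cB d)⁻¹ := by
        refine mul_le_mul (mul_le_mul (mul_le_mul hpre hs1 (norm_nonneg _) h1) hs2 (norm_nonneg _)
          (mul_nonneg h1 (sideWt_nonneg n s k))) hdi (norm_nonneg _) ?_
        exact mul_nonneg (mul_nonneg h1 (sideWt_nonneg n s k)) (sideWt_nonneg n s k')
    _ = CG d s * sideWt n s k * sideWt n s k' := by unfold CG; rw [div_eq_mul_inv]; ring

/-- [folklore] **THE ENTRY BOUNDS ON THE STRIP, UNIFORMLY IN `n ≥ 1`**, off the `(0,0)` entry: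
`‖Gfib n s k k′ p‖ ≤ [k = k′ ≠ 0]·((64∕7)∕W_k)^s + CG d s · wt n s k · wt n s k′` on `Strip d (kappaB d s)`. -/
theorem norm_Gfib_le (n : ℕ) [NeZero n] (s : ℕ) (k k' : Fin d → Fin n) (hkk : ¬(k = (fun _ => (0 : Fin n)) ∧ k' = (fun _ => (0 : Fin n))))
    {p : Fin d → ℂ} (hp : p ∈ Strip d (kappaB d s)) :
    ‖Gfib n s k k' p‖ ≤ (if k = k' ∧ k ≠ (fun _ => (0 : Fin n)) then ((64 / 7) / W n k) ^ s else 0) + CG d s * wt n s k * wt n s k' := by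
  have hfat : p ∈ Fat d (rOf d) := strip_subset_fat (rOf_pos d).le (kappaB_le_rOf d s) hp
  have hF := norm_F_zero_le n (rOf_le d) k hfat
  have hFc := norm_Fc_zero_le n (rOf_le d) k' hfat
  have hco := norm_coef_le n s k k' hp
  have hP : 0 ≤ ∏ ν, 12 / omega n (k ν) := Finset.prod_nonneg fun ν _ => by
    have := omega_pos n (k ν) (k ν).isLt; positivity
  have hP' : 0 ≤ ∏ ν, 12 / omega n (k' ν) := Finset.prod_nonneg fun ν _ => by
    have := omega_pos n (k' ν) (k' ν).isLt; positivity
  have hrank : ‖F n (fun _ => 0) k p * Fc n (fun _ => 0) k' p * coef n s k k' p‖ ≤ CG d s * wt n s k * wt n s k' := by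
    rw [norm_mul, norm_mul]
    calc ‖F n (fun _ => 0) k p‖ * ‖Fc n (fun _ => 0) k' p‖ * ‖coef n s k k' p‖
        ≤ (∏ ν, 12 / omega n (k ν)) * (∏ ν, 12 / omega n (k' ν)) * (CG d s * sideWt n s k * sideWt n s k') :=
          mul_le_mul (mul_le_mul hF hFc (norm_nonneg _) hP) hco (norm_nonneg _) (mul_nonneg hP hP')
      _ = CG d s * wt n s k * wt n s k' := by unfold wt; ring
  unfold Gfib
  rw [if_neg hkk]
  refine (norm_sub_le _ _).trans (add_le_add ?_ hrank)
  by_cases hkk' : k = k'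
  · subst hkk'
    have hk0 : k ≠ fun _ => (0 : Fin n) := fun h => hkk ⟨h, h⟩
    rw [if_pos rfl, if_pos ⟨rfl, hk0⟩]
    exact norm_ainv_le n s (rOf_le d) (d_mul_rOf_sq_le d) hfat k hk0
  · rw [if_neg hkk', if_neg (fun h => hkk' h.1), norm_zero]

/-- [folklore] The `k = k′ = 0` entry: `‖Gfib n s 0 0 p‖ = ‖Spr∕den‖ ≤ 132^d·(64∕7)^s∕cB d` on the strip, every `n ≥ 1`. -/
theorem norm_Gfib_zero_zero_le (n : ℕ) [NeZero n] (s : ℕ) {p : Fin d → ℂ} (hp : p ∈ Strip d (kappaB d s)) :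
    ‖Gfib n s (fun _ => (0 : Fin n)) (fun _ => (0 : Fin n)) p‖ ≤ 132 ^ d * (64 / 7) ^ s / cB d := by
  have hfat : p ∈ Fat d (rOf d) := strip_subset_fat (rOf_pos d).le (kappaB_le_rOf d s) hp
  unfold Gfib
  rw [if_pos ⟨rfl, rfl⟩, norm_div, div_eq_mul_inv, div_eq_mul_inv]
  have h1 := norm_Spr_le n s (rOf_le d) (d_mul_rOf_sq_le d) hfat
  have h2 : ‖den n s p‖⁻¹ ≤ (cB d)⁻¹ := by
    have := norm_inv_den_le_strip n s hp
    rwa [norm_inv] at this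
  exact mul_le_mul h1 h2 (inv_nonneg.mpr (norm_nonneg _)) (by positivity)

/-! ## §3 Holomorphy on the strip -/

/-- [folklore] `side n s k` is holomorphic on the fat region. -/
theorem differentiableAt_side (n : ℕ) [NeZero n] (s : ℕ) {r : ℝ} (hr : r ≤ 1 / 4) (hdr : (d : ℝ) * r ^ 2 ≤ 1 / 16)
    {q : Fin d → ℂ} (hq : q ∈ Fat d r) (k : Fin d → Fin n) : DifferentiableAt ℂ (side n s k) q := by
  by_cases h : k = fun _ => (0 : Fin n)
  · have : side n s k = fun _ => (1 : ℂ) := by funext p; unfold side; rw [if_pos h]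
    rw [this]; exact differentiableAt_const _
  · have : side n s k = ainv n s k := by funext p; unfold side; rw [if_neg h]
    rw [this]; exact differentiableAt_ainv n s hr hdr hq k h

/-- [folklore] `coef n s k k′` is holomorphic (jointly) at every point of the strip `Strip d (kappaB d s)`. -/
theorem differentiableAt_coef (n : ℕ) [NeZero n] (s : ℕ) (k k' : Fin d → Fin n) {p : Fin d → ℂ}
    (hp : p ∈ Strip d (kappaB d s)) : DifferentiableAt ℂ (coef n s k k') p := by
  have hfat : p ∈ Fat d (rOf d) := strip_subset_fat (rOf_pos d).le (kappaB_le_rOf d s) hp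
  have hpre : DifferentiableAt ℂ
      (fun q : Fin d → ℂ => (if k ≠ (fun _ => (0 : Fin n)) ∧ k' ≠ (fun _ => (0 : Fin n)) then DeltaXi n 0 q ^ s else (1 : ℂ))) p := by
    split_ifs
    · exact (differentiableAt_DeltaXi n 0 p).pow s
    · exact differentiableAt_const _
  show DifferentiableAt ℂ (fun q => (if k ≠ (fun _ => (0 : Fin n)) ∧ k' ≠ (fun _ => (0 : Fin n)) then DeltaXi n 0 q ^ s else 1) *
    side n s k q * side n s k' q / den n s q) p
  exact dAt_div ((hpre.mul (differentiableAt_side n s (rOf_le d) (d_mul_rOf_sq_le d) hfat k)).mul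
    (differentiableAt_side n s (rOf_le d) (d_mul_rOf_sq_le d) hfat k')) (differentiableAt_den_strip n s hp) (den_ne_zero_strip n s hp)

/-- [folklore] **THE REGROUPED FIBRE ENTRIES ARE HOLOMORPHIC (jointly) AT EVERY POINT OF THE STRIP `Strip d (kappaB d s)`**, every `n ≥ 1`,
every `k, k′` — including `p′ = 0`, where the un-regrouped Sherman–Morrison entries are singular. -/
theorem differentiableAt_Gfib (n : ℕ) [NeZero n] (s : ℕ) (k k' : Fin d → Fin n) {p : Fin d → ℂ}
    (hp : p ∈ Strip d (kappaB d s)) : DifferentiableAt ℂ (Gfib n s k k') p := by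
  have hfat : p ∈ Fat d (rOf d) := strip_subset_fat (rOf_pos d).le (kappaB_le_rOf d s) hp
  by_cases hkk : k = (fun _ => (0 : Fin n)) ∧ k' = (fun _ => (0 : Fin n))
  · have : Gfib n s k k' = fun q => Spr n s q / den n s q := by funext q; unfold Gfib; rw [if_pos hkk]
    rw [this]
    exact dAt_div (differentiableAt_Spr n s (rOf_le d) (d_mul_rOf_sq_le d) hfat) (differentiableAt_den_strip n s hp)
      (den_ne_zero_strip n s hp)
  · have : Gfib n s k k' = fun q => (if k = k' then ainv n s k q else 0) -
        F n (fun _ => 0) k q * Fc n (fun _ => 0) k' q * coef n s k k' q := by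
      funext q; unfold Gfib; rw [if_neg hkk]
    rw [this]
    refine DifferentiableAt.sub ?_ (((differentiableAt_F n _ k p).mul (differentiableAt_Fc n _ k' p)).mul
      (differentiableAt_coef n s k k' hp))
    by_cases hkk' : k = k'
    · subst hkk'
      have hk0 : k ≠ fun _ => (0 : Fin n) := fun h => hkk ⟨h, h⟩
      simp only [if_true]
      exact differentiableAt_ainv n s (rOf_le d) (d_mul_rOf_sq_le d) hfat k hk0
    · simp only [hkk', if_false]
      exact differentiableAt_const _

end Summit.QuantumFields.BalabanUV.Beta.FP.ConstrainedBiLaplacianFibreEntries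

end
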